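import Mathlib

/-!
# NE7K1LinHomTensor — row NE7 (node U5), candidate route HOM, path H1L, cell K1-lin(s): THE TENSOR LEMMA — a product kernel's
# squared sums are bounded by the PRODUCT of the one-dimensional ℓ²-constants

Lineage `b2b-balaban-t4-ne7-p2` (CRUX PROVER NE7 #2), generation 67 (second file; g66's OPEN item (4)(ii)).  The directional
energy of the homogenised lift is `Σ_x (Σ_Y g_Y·c_ν(x,Y))²` with the PRODUCT kernel `c_ν(x,Y) = Π_μ κ_μ(x_μ, Y_μ)`
(`NE7K1LinHomLift.bondK`: the bond kernel in direction `ν`, the interpolation kernel in the transverse directions).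
`NE7K1LinHomGramUpper.energy_dir_le_gram` expands the square and Schur-tests the product GRAM matrix, which charges every factor its
ABSOLUTE row sum.  This file proves the ℓ² statement that charges every factor its OPERATOR NORM instead — all [folklore]:

* `sum_piFinset_succ`: splitting a sum over `Fintype.piFinset S` (`S : Fin (n+1) → Finset ι`) into the first coordinate and
  the tail (`Fin.cons` ∕ `Fin.tail`).
* **`sq_sum_prod_kernel_le`**: if for every coordinate `μ` the one-dimensional kernel satisfies
  `Σ_{t ∈ T_μ} (Σ_{y ∈ S_μ} κ_μ(t,y)·h_y)² ≤ c_μ·Σ_{y ∈ S_μ} h_y²` for all `h` (`c_μ ≥ 0`), then for every `g` on `Π_μ S_μ`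
  `Σ_{x ∈ Π_μ T_μ} (Σ_{Y ∈ Π_μ S_μ} g_Y·Π_μ κ_μ(x_μ,Y_μ))² ≤ (Π_μ c_μ)·Σ_Y g_Y²` — by contracting ONE coordinate at a time
  (induction on the number of coordinates: the partially contracted function `u_t(Y′) = Σ_a κ₀(t,a)·g(a, Y′)` is fed to the
  induction hypothesis, then the first factor's bound is applied fibrewise).  No Gram matrix, no sign blindness: the
  one-dimensional constants may be spectral (ℓ²) constants.

`NE7K1LinHomSpecUpper` applies it with `NE7K1LinHomKerSpec.kerF_sq_sum_le` (`6∕5·L` per transverse direction) and the bond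
factor `3∕L`.

HONEST FRAMING: finite sums of real numbers ([folklore]); no lattice field, no operator of Bałaban's; it serves a census ∕
NEEDS-CONSTANT sharpening of the L-uniform upper two-run constant at `A = 0` (Gaussian, one RG step, `U = 1`, finite boxes).
FIXED FINITE T⁴, rung (B)+1; NE7 NOT PRINTED ∕ NOT PROVED; spine 0∕9; NOT infinite volume, NOT mass gap, NOT Clay.  HONEST DEPENDENCY:
continuum YM on T⁴ ⇐ BetaPertH ∧ nine spine estimates (0/9 proved); BetaPertH ⇐ (D1) ∧ (D4) ∧ CAP+tail; G-an2-4 gates asym, D1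
and NE2/3/4.
-/

noncomputable section

open Finset

namespace Summit.QuantumFields.BalabanUV.T4Continuum.NE7K1LinHomTensor

/-! ### §1 Splitting a sum over a product of finsets at the first coordinate -/

/-- **FIRST-COORDINATE SPLITTING**: `Σ_{Y ∈ Π_{μ<n+1} S_μ} F(Y) = Σ_{a ∈ S_0} Σ_{Y′ ∈ Π_{i<n} S_{i+1}} F(cons a Y′)`. [folklore] -/
theorem sum_piFinset_succ {ι : Type*} {n : ℕ} (S : Fin (n + 1) → Finset ι) (F : (Fin (n + 1) → ι) → ℝ) :
    ∑ Y ∈ Fintype.piFinset S, F Y = ∑ a ∈ S 0, ∑ Y' ∈ Fintype.piFinset (Fin.tail S), F (Fin.cons a Y') := by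
  rw [← Finset.sum_product' (S 0) (Fintype.piFinset (Fin.tail S)) (fun a Y' => F (Fin.cons a Y'))]
  refine Finset.sum_nbij' (fun Y => (Y 0, Fin.tail Y)) (fun x => Fin.cons x.1 x.2) ?_ ?_ ?_ ?_ ?_
  · intro Y hY
    rw [Fintype.mem_piFinset] at hY
    rw [Finset.mem_product, Fintype.mem_piFinset]
    exact ⟨hY 0, fun i => hY i.succ⟩
  · intro x hx
    rw [Finset.mem_product, Fintype.mem_piFinset] at hx
    rw [Fintype.mem_piFinset]
    intro i
    refine Fin.cases ?_ (fun j => ?_) i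
    · rw [Fin.cons_zero]; exact hx.1
    · rw [Fin.cons_succ]; exact hx.2 j
  · intro Y _
    exact Fin.cons_self_tail Y
  · intro x _
    rw [Fin.cons_zero, Fin.tail_cons]
  · intro Y _
    rw [Fin.cons_self_tail]

/-! ### §2 The tensor lemma -/

/-- **THE TENSOR LEMMA**: one-dimensional squared-sum (ℓ²) bounds with constants `c_μ ≥ 0` for each factor kernel `κ_μ` imply
the bound with constant `Π_μ c_μ` for the product kernel `Π_μ κ_μ(x_μ, Y_μ)` on the product sets — proved by contracting one
coordinate at a time. [folklore] -/
theorem sq_sum_prod_kernel_le {ι τ : Type*} :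
    ∀ (n : ℕ) (S : Fin n → Finset ι) (T : Fin n → Finset τ) (κ : Fin n → τ → ι → ℝ) (c : Fin n → ℝ),
      (∀ μ, 0 ≤ c μ) →
      (∀ μ (h : ι → ℝ), ∑ t ∈ T μ, (∑ y ∈ S μ, κ μ t y * h y) ^ 2 ≤ c μ * ∑ y ∈ S μ, h y ^ 2) →
      ∀ g : (Fin n → ι) → ℝ,
        ∑ x ∈ Fintype.piFinset T, (∑ Y ∈ Fintype.piFinset S, g Y * ∏ μ, κ μ (x μ) (Y μ)) ^ 2 ≤
          (∏ μ, c μ) * ∑ Y ∈ Fintype.piFinset S, g Y ^ 2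
  | 0, S, T, κ, c, _, _, g => by
      simp only [Fintype.piFinset_of_isEmpty, Finset.univ_unique, Finset.sum_singleton, Fin.prod_univ_zero, mul_one, one_mul,
        le_refl]
  | n + 1, S, T, κ, c, hc, hker, g => by
      have IH := fun t : τ => sq_sum_prod_kernel_le n (Fin.tail S) (Fin.tail T) (fun i => κ i.succ) (fun i => c i.succ)
        (fun i => hc i.succ) (fun i h => hker i.succ h) (fun Y' => ∑ a ∈ S 0, κ 0 t a * g (Fin.cons a Y'))
      have inner : ∀ (t : τ) (x' : Fin n → τ), ∑ Y ∈ Fintype.piFinset S, g Y * ∏ μ, κ μ ((Fin.cons t x' : Fin (n + 1) → τ) μ) (Y μ) =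
          ∑ Y' ∈ Fintype.piFinset (Fin.tail S), (∑ a ∈ S 0, κ 0 t a * g (Fin.cons a Y')) *
            ∏ i : Fin n, κ i.succ (x' i) (Y' i) := by
        intro t x'
        rw [sum_piFinset_succ S, Finset.sum_comm]
        refine Finset.sum_congr rfl fun Y' _ => ?_
        rw [Finset.sum_mul]
        refine Finset.sum_congr rfl fun a _ => ?_
        rw [Fin.prod_univ_succ]
        simp only [Fin.cons_zero, Fin.cons_succ]
        ring
      have hc' : 0 ≤ ∏ i : Fin n, c i.succ := Finset.prod_nonneg fun i _ => hc i.succ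
      rw [sum_piFinset_succ T, sum_piFinset_succ S (fun Y => g Y ^ 2), Fin.prod_univ_succ]
      calc ∑ t ∈ T 0, ∑ x' ∈ Fintype.piFinset (Fin.tail T),
            (∑ Y ∈ Fintype.piFinset S, g Y * ∏ μ, κ μ ((Fin.cons t x' : Fin (n + 1) → τ) μ) (Y μ)) ^ 2
          = ∑ t ∈ T 0, ∑ x' ∈ Fintype.piFinset (Fin.tail T),
              (∑ Y' ∈ Fintype.piFinset (Fin.tail S), (∑ a ∈ S 0, κ 0 t a * g (Fin.cons a Y')) *
                ∏ i : Fin n, κ i.succ (x' i) (Y' i)) ^ 2 :=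
            Finset.sum_congr rfl fun t _ => Finset.sum_congr rfl fun x' _ => by rw [inner]
        _ ≤ ∑ t ∈ T 0, (∏ i : Fin n, c i.succ) *
              ∑ Y' ∈ Fintype.piFinset (Fin.tail S), (∑ a ∈ S 0, κ 0 t a * g (Fin.cons a Y')) ^ 2 :=
            Finset.sum_le_sum fun t _ => IH t
        _ = (∏ i : Fin n, c i.succ) *
              ∑ Y' ∈ Fintype.piFinset (Fin.tail S), ∑ t ∈ T 0, (∑ a ∈ S 0, κ 0 t a * g (Fin.cons a Y')) ^ 2 := by
            rw [← Finset.mul_sum, Finset.sum_comm]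
        _ ≤ (∏ i : Fin n, c i.succ) *
              ∑ Y' ∈ Fintype.piFinset (Fin.tail S), (c 0 * ∑ a ∈ S 0, g (Fin.cons a Y') ^ 2) :=
            mul_le_mul_of_nonneg_left (Finset.sum_le_sum fun Y' _ => hker 0 (fun a => g (Fin.cons a Y'))) hc'
        _ = c 0 * (∏ i : Fin n, c i.succ) * ∑ a ∈ S 0, ∑ Y' ∈ Fintype.piFinset (Fin.tail S), g (Fin.cons a Y') ^ 2 := by
            rw [← Finset.mul_sum, Finset.sum_comm]
            ring

end Summit.QuantumFields.BalabanUV.T4Continuum.NE7K1LinHomTensor
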